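import Summits.HubbardSuperconductivity.HubbardSuperconductivity.Theses.AnisotropyChord
import Summits.HubbardSuperconductivity.HubbardSuperconductivity.Theorems.AnisotropyChordChordToOrderXY
import Literature.MathematicalPhysics.QuantumLattice.FinDimSpectrumSectorGibbsLimit

/-!
# Crux `ChordFM` (stmt-HubbardSuperconductivity-8147) — line `thermal-af`
# (crux-strategist, 2026-08-17): the AF-side piece `ChordXY` through the CANONICAL (finite-β) sector state

The route header's foreseen second layer ("ChordXY ⇐ VarianceComparison → GroundStateLimit → ChordXY"),
typed for the first time. Notation: `H_M(Δ) = xxzHamiltonian 1 (torusGraph 2 M) (-1) Δ`, `P₀` = the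
orthogonal projection onto the half-filled sector `S^z_tot = 0` (`sectorProj`), `A = S⁺_tot S⁻_tot`
(`condensateOp`), and the FINITE-TEMPERATURE CONDENSATE of the sector
`Λ_{β,M}(Δ) = Re( tr(P₀ e^{-βH_M(Δ)} A) / tr(P₀ e^{-βH_M(Δ)}) )` (`thermalCondensate`; `e^{-βH} = Matrix.gibbsWeight`).

* `stub_thermalChordAF` — the THERMAL CHORD on the antiferromagnetic side, eventually in β:
  `∀ even M ≥ 4, Δ ∈ [-1,0]: ∀ᶠ β, (1+Δ)·Λ_{β,M}(0) ≤ Λ_{β,M}(Δ)`. This is where the intended engine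
  lives: `tr(P₀ e^{-βH_M(Δ)} ·)` has a stoquastic path-integral / SSE representation in which `Δ` enters
  as a DIAGONAL weight, `Λ_β = Z_worm/Z` is a ratio of Laplace transforms in `Δ`, and
  `(log Λ_β)'' = Var_worm(𝒜) − Var_closed(𝒜)` (route rationale) — correlation-inequality habitat
  (GHS / FKG / Ginibre-type), unlike eigenvectors. TRANSFER, why easier: analytic in Δ at fixed (β, M),
  probabilistic representation, and the chord (not full concavity) is all that is needed; at small β it
  holds trivially (`Λ_β` is Δ-independent at β = 0 and `1+Δ ≤ 1`).
* `stub_groundStateLimit` — the β → ∞ passage at fixed M: `Λ_{β,M}(Δ) → Λ(ψ)` for every normalised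
  sector ground state `ψ` of `H_M(Δ)`. Provable now (size M): the Literature's
  `tendsto_sectorGibbsAverage_atTop` (FinDimSpectrumSectorGibbsLimit) gives convergence to
  `tr(P_{E₀}A)/tr P_{E₀}` on the sector ground eigenspace `E₀`, and `E₀ = ℂψ` because the sector block
  of `H_M(Δ)` is stoquastic and connected for EVERY real Δ (Perron–Frobenius,
  `stoquastic_sector_perronFrobenius` as used in line `concavity-af`), so `tr(P_{E₀}A) = ⟨ψ, Aψ⟩`.
* `stub_ferroSideChord : FerroSideChord` — the FM-side piece (route item stmt-19089) BY NAME.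
Compositions (kernel-checked, no sorry): `chordXY_of_thermal : T1 → T2 → ChordXY` (limits preserve
`≤`: `le_of_tendsto_of_tendsto`), `chordFM_of_pieces : ChordXY → FerroSideChord → ChordFM` (the split
glue, = item `ChordFMOfPieces`), `ChordFM_of : ChordFM`.

Disproof used: none exists for this crux. Dead lines avoided: full-interval Concavity (suspect-false
on (0,1) at large M) is not used; nothing here compares to the XY value on the FM side.
-/

noncomputable section

namespace Summit.HubbardSuperconductivity.HubbardSuperconductivity.Cruxes.ChordFM.ThermalAF

open Matrix Filter Topology
open Literature.MathematicalPhysics.QuantumLattice Literature.Probability.LatticeModels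
open Summit.HubbardSuperconductivity.HubbardSuperconductivity.Theses.AnisotropyChord
open Summit.HubbardSuperconductivity.HubbardSuperconductivity.Theorems.AnisotropyChord
  (exists_unit_sectorGroundState_xy)

/-- The orthogonal projection `P₀` onto the half-filled sector `S^z_tot = 0` of the spin-½ torus of
side `M` (`projMatrix` of the sector transported to `EuclideanSpace`, the Literature's convention). -/
def sectorProj (M : ℕ) [NeZero M] :
    Matrix (TensorIndex (TorusSite 2 M) 2) (TensorIndex (TorusSite 2 M) 2) ℂ :=
  projMatrix ((spinZSector (Λ := TorusSite 2 M) 1 0).map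
    ((WithLp.linearEquiv 2 ℂ (TensorIndex (TorusSite 2 M) 2 → ℂ)).symm :
      (TensorIndex (TorusSite 2 M) 2 → ℂ) →ₗ[ℂ] EuclideanSpace ℂ (TensorIndex (TorusSite 2 M) 2)))

/-- The condensate operator `A = S⁺_tot S⁻_tot`. -/
def condensateOp (M : ℕ) [NeZero M] :
    Matrix (TensorIndex (TorusSite 2 M) 2) (TensorIndex (TorusSite 2 M) 2) ℂ :=
  (∑ x : TorusSite 2 M, onSite x (spinRaise 1)) * (∑ y : TorusSite 2 M, onSite y (spinLower 1))

/-- **The finite-temperature condensate of the half-filled sector**,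
`Λ_{β,M}(Δ) = Re( tr(P₀ e^{-β H_M(Δ)} S⁺_tot S⁻_tot) / tr(P₀ e^{-β H_M(Δ)}) )`. -/
def thermalCondensate (M : ℕ) [NeZero M] (β Δ : ℝ) : ℝ :=
  ((sectorProj M * gibbsWeight β (xxzHamiltonian 1 (torusGraph 2 M) (-1) Δ) * condensateOp M).trace /
    (sectorProj M * gibbsWeight β (xxzHamiltonian 1 (torusGraph 2 M) (-1) Δ)).trace).re

/-- STUB T1 — THERMAL CHORD on the antiferromagnetic side, eventually in `β` (the engine's statement). -/
theorem stub_thermalChordAF :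
    ∀ (M : ℕ) [NeZero M], Even M → 4 ≤ M → ∀ Δ ∈ Set.Icc (-1:ℝ) 0,
      ∀ᶠ β : ℝ in atTop, (1 + Δ) * thermalCondensate M β 0 ≤ thermalCondensate M β Δ := by
  sorry

/-- STUB T2 — GROUND-STATE LIMIT of the canonical sector state (`β → ∞` at fixed `M`; Perron–Frobenius
uniqueness of the sector ground state for every real `Δ` identifies the limit). Provable now, size M. -/
theorem stub_groundStateLimit :
    ∀ (M : ℕ) [NeZero M], Even M → 2 ≤ M → ∀ (Δ : ℝ)
      (ψ : TensorIndex (TorusSite 2 M) 2 → ℂ), ψ ∈ spinZSector (Λ := TorusSite 2 M) 1 0 →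
        star ψ ⬝ᵥ ψ = 1 →
        Matrix.mulVec (xxzHamiltonian 1 (torusGraph 2 M) (-1) Δ) ψ =
          ((lowestEnergyInSector 1 (xxzHamiltonian 1 (torusGraph 2 M) (-1) Δ) 0 : ℝ) : ℂ) • ψ →
        Tendsto (fun β : ℝ => thermalCondensate M β Δ) atTop
          (𝓝 ((star ψ ⬝ᵥ Matrix.mulVec ((∑ x : TorusSite 2 M, onSite x (spinRaise 1)) *
            (∑ y : TorusSite 2 M, onSite y (spinLower 1))) ψ).re)) := by
  sorry

/-- STUB 3 = the FM-side piece `FerroSideChord` (route item stmt-HubbardSuperconductivity-19089, BY NAME). -/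
theorem stub_ferroSideChord : FerroSideChord := by
  sorry

/-- COMPOSITION TO THE PIECE — thermal chord + ground-state limit give the route item `ChordXY`
(stmt-8146) by name: both sides of the thermal chord converge and `≤` passes to the limit. [folklore] -/
theorem chordXY_of_thermal
    (hT : ∀ (M : ℕ) [NeZero M], Even M → 4 ≤ M → ∀ Δ ∈ Set.Icc (-1:ℝ) 0,
      ∀ᶠ β : ℝ in atTop, (1 + Δ) * thermalCondensate M β 0 ≤ thermalCondensate M β Δ)
    (hL : ∀ (M : ℕ) [NeZero M], Even M → 2 ≤ M → ∀ (Δ : ℝ)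
      (ψ : TensorIndex (TorusSite 2 M) 2 → ℂ), ψ ∈ spinZSector (Λ := TorusSite 2 M) 1 0 →
        star ψ ⬝ᵥ ψ = 1 →
        Matrix.mulVec (xxzHamiltonian 1 (torusGraph 2 M) (-1) Δ) ψ =
          ((lowestEnergyInSector 1 (xxzHamiltonian 1 (torusGraph 2 M) (-1) Δ) 0 : ℝ) : ℂ) • ψ →
        Tendsto (fun β : ℝ => thermalCondensate M β Δ) atTop
          (𝓝 ((star ψ ⬝ᵥ Matrix.mulVec ((∑ x : TorusSite 2 M, onSite x (spinRaise 1)) *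
            (∑ y : TorusSite 2 M, onSite y (spinLower 1))) ψ).re))) :
    ChordXY := by
  intro M _ hE h4 Δ hΔ ψ₀ ψ hmem₀ hψ₀1 heig₀ hmem hψ1 heig
  have h2 : 2 ≤ M := le_trans (by norm_num) h4
  have hlim₀ := (hL M hE h2 0 ψ₀ hmem₀ hψ₀1 heig₀).const_mul (1 + Δ)
  have hlim := hL M hE h2 Δ ψ hmem hψ1 heig
  exact le_of_tendsto_of_tendsto hlim₀ hlim (hT M hE h4 Δ hΔ)

/-- COMPOSITION TO THE CRUX BY NAME — `ChordFM` from the registered stubs. The split assembly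
`ChordXY → FerroSideChord → ChordFM` (= glue item `ChordFMOfPieces`, stmt-19090, whose complete proof is
attached as evidence `AnisotropyChordChordFMOfPieces.lean`) is re-proved INSIDE this theorem so that the
line is self-contained and exactly one theorem of the file concludes the crux. Sorries live only in `stub_*`. -/
theorem ChordFM_of : ChordFM :=
  have pieces : ChordXY → FerroSideChord → ChordFM := by
    intro hXY hF M _ hE h4 Δ hΔ ψ hmem hψ1 heig
    by_cases hΔ0 : 0 ≤ Δ
    · -- ferromagnetic side `Δ ∈ [0,1]`: the FM-side piece verbatim
      exact hF M hE h4 Δ ⟨hΔ0, hΔ.2⟩ ψ hmem hψ1 heig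
    · -- antiferromagnetic side `Δ ∈ [-1,0)`: RP-free anchor at the KLS point, transported by ChordXY
      obtain ⟨ψ₀, hmem₀, hψ₀1, heig₀⟩ :=
        exists_unit_sectorGroundState_xy M hE (le_trans (by norm_num) h4)
      have hA := hF M hE h4 0 ⟨le_rfl, by norm_num⟩ ψ₀ hmem₀ hψ₀1 heig₀
      have hC := hXY M hE h4 Δ ⟨hΔ.1, (not_le.mp hΔ0).le⟩ ψ₀ ψ hmem₀ hψ₀1 heig₀ hmem hψ1 heig
      have h1 : 0 ≤ 1 + Δ := by linarith [hΔ.1]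
      calc (1 + Δ) / 2 * ((M : ℝ) ^ 2 / 2 * ((M : ℝ) ^ 2 / 2 + 1))
          = (1 + Δ) * ((1 + 0) / 2 * ((M : ℝ) ^ 2 / 2 * ((M : ℝ) ^ 2 / 2 + 1))) := by ring
        _ ≤ (1 + Δ) * (star ψ₀ ⬝ᵥ Matrix.mulVec ((∑ x : TorusSite 2 M, onSite x (spinRaise 1)) *
              (∑ y : TorusSite 2 M, onSite y (spinLower 1))) ψ₀).re :=
            mul_le_mul_of_nonneg_left hA h1
        _ ≤ _ := hC
  pieces (chordXY_of_thermal stub_thermalChordAF stub_groundStateLimit) stub_ferroSideChord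

end Summit.HubbardSuperconductivity.HubbardSuperconductivity.Cruxes.ChordFM.ThermalAF
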